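import Literature.Algebra.Polynomial.SteffensenSequences
import Literature.Algebra.Polynomial.HermiteAppellSequence
import Mathlib.RingTheory.PowerSeries.Derivative
import Mathlib.Data.Nat.Factorial.DoubleFactorial
import Mathlib.Tactic
import HarnessLib

/-!
# The Hermite polynomials of variance `v` as an Appell cross-sequence (Rota–Kahaner–Odlyzko §10)

G.-C. Rota, D. Kahaner, A. Odlyzko, *Finite operator calculus* (1973), §10 "Hermite polynomials",
pp. 721–723, 726:

> Define the Hermite polynomials of variance `v` to be the Appell set (as we shall see, the Appell
> cross-sequence) whose operator is the Weierstrass operator `W_v p (x) = (2πv)^{−1/2} ∫ e^{−t²/2v}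
> p (x + t) dt` (*). The ordinary Hermite polynomials correspond to variance one. Thus
> `H_n^{(v)} (x) = W_v⁻¹ xⁿ`, `D H_n^{(v)} (x) = n H_{n−1}^{(v)} (x)`,
> `H_n^{(v)} (x + y) = Σ_k C(n,k) y^{n−k} H_k^{(v)} (x)`, etc. … The indicator of the operator `W_v` is
> `W_v = Σ_n a_n^{(v)} Dⁿ/n!` with `a_n^{[v]} = v^{n/2} · 1·3·5⋯(n−1)` for `n` even, `0` for `n` odd (**).
> … Thus `W_v = e^{vD²/2}` (***). We infer that `H_n^{(v)} (x) = H_n^{[v]} (x)` is a cross-sequence.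
> Note that the definition of the Weierstrass operator by (*) is valid only for `v > 0`, but (***)
> always holds. Next, `H_n^{[v+μ]} (x + y) = Σ_k C(n,k) H_k^{[v]} (x) H_{n−k}^{[μ]} (y)` …
> Proposition 5 of Section 8 gives the umbral composition formula
> `H^{[v]} (H^{[μ]} (x)) = H^{[v+μ]} (x)` … The generating function `Σ_n H_n^{[v]} (x) tⁿ/n! = e^{xt − vt²/2}`
> is also immediate from Section 5, Proposition 5. The (classical) Rodrigues formula follows using
> the Pincherle derivative … this also proves the recurrence formulas, stated for `v = 1` for
> convenience, `H_{n+1} (x) = x H_n (x) − H_n′ (x) = x H_n (x) − n H_{n−1} (x)` …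
> (p. 726) the Hermite polynomials are … eigenfunctions, with eigenvalues `n`, of `A = xD − D²`.

Over a field `K` of characteristic `0` only (***) makes sense, and we take it as the definition:
`hermiteVar v n = H_n^{[v]} = e^{−vD²/2} xⁿ = exp (v · F)(D) xⁿ` with the generator `F = −t²/2`
(`expOp` of `CrossSequences.lean`; `e^{−vt²/2} = (e^{−(v/2) s}) ∘ (s = t²)`,
`rescale_exp_subst_negHalfSq`). For `v = 1` this is Mathlib's `Polynomial.hermite` mapped to `K`
(`hermiteVar_one`, through the tree's `hermite_eq_diffOp_X_pow`).

Definitions (with bodies): `hermiteVar`.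
Main statements: `coeff_rescale_exp_subst_X_sq`, `factorial_mul_coeff_weierstrass` ((**): the indicator
coefficients `a_n^{[v]}`), `hermiteVar_one`, `isCrossSequence_hermiteVar` ((***) ⇒ cross-sequence),
`isAppellSequence_hermiteVar`, `hermiteVar_eval_add` (the Appell identity), `hermiteVar_add_eval_add`
(the cross identity), `umbralComp_hermiteVar` (composition formula), `hermiteVar_eq_sum` (explicit
coefficients), `egf_hermiteVar` (generating function), `derivative_weierstrassInv` (`(e^{−vt²/2})′ =
−vt e^{−vt²/2}`), `hermiteVar_succ` / `hermiteVar_succ'` (the recurrences `H_{n+1} = x H_n − v H_n′ =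
x H_n − vn H_{n−1}`), `hermiteVar_eq_iterate` (`H_n^{[v]} = (x − vD)ⁿ 1`),
`X_mul_derivative_hermiteVar_sub` (`x H′ − v H″ = n H`, the eigen-equation of `A_v = xD − vD²`).

## References
* [RotaKahanerOdlyzko1973] G.-C. Rota, D. Kahaner, A. Odlyzko, *On the foundations of
  combinatorial theory VIII. Finite operator calculus*, J. Math. Anal. Appl. 42 (1973) 684–760,
  §10 pp. 721–723, 726.
-/

noncomputable section

open Polynomial Finset

namespace Literature.Algebra.Polynomial

variable {K : Type*} [Field K] [CharZero K]

/-! ## The generator `F = −t²/2` and the series `e^{ct²}` -/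

variable (K) in
omit [CharZero K] in
/-- `F = −t²/2` has no constant term. [cite: RotaKahanerOdlyzko1973, §10 (***), p. 722] -/
theorem constantCoeff_negHalfSq :
    PowerSeries.constantCoeff ((-(2⁻¹ : K)) • (PowerSeries.X : PowerSeries K) ^ 2) = 0 := by
  rw [← PowerSeries.coeff_zero_eq_constantCoeff_apply, PowerSeries.coeff_smul, PowerSeries.coeff_X_pow,
    if_neg (by decide), smul_zero]

/-- **`e^{vF} = e^{−vt²/2} = (e^{−(v/2) s})|_{s = t²}`**: the exponential of the generator as a substitution
into `t²` (the form whose coefficients are immediate). [cite: RotaKahanerOdlyzko1973, §10 (***), p. 722] -/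
theorem rescale_exp_subst_negHalfSq (v : K) :
    ((PowerSeries.rescale v (PowerSeries.exp K)).subst ((-(2⁻¹ : K)) • (PowerSeries.X : PowerSeries K) ^ 2) :
        PowerSeries K) =
      (PowerSeries.rescale (-(v / 2)) (PowerSeries.exp K)).subst ((PowerSeries.X : PowerSeries K) ^ 2) := by
  have hX2 : PowerSeries.HasSubst ((PowerSeries.X : PowerSeries K) ^ 2) := PowerSeries.HasSubst.X_pow two_ne_zero
  rw [show -(v / 2) = v * -(2⁻¹ : K) by ring, ← PowerSeries.rescale_rescale, PowerSeries.rescale_eq_subst (-(2⁻¹ : K)),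
    PowerSeries.subst_comp_subst_apply (PowerSeries.HasSubst.smul_X' _) hX2,
    PowerSeries.subst_smul hX2, PowerSeries.subst_X hX2]

/-- **The coefficients of `e^{cs}|_{s=t²} = Σ_m c^m t^{2m}/m!`.**
[cite: RotaKahanerOdlyzko1973, §10 (**), p. 722] -/
theorem coeff_rescale_exp_subst_X_sq (c : K) (n : ℕ) :
    PowerSeries.coeff n ((PowerSeries.rescale c (PowerSeries.exp K)).subst ((PowerSeries.X : PowerSeries K) ^ 2)) =
      if Even n then c ^ (n / 2) / ((n / 2).factorial : K) else 0 := by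
  rw [PowerSeries.coeff_subst_X_pow two_ne_zero, Algebra.algebraMap_self_apply, PowerSeries.coeff_rescale,
    PowerSeries.coeff_exp, map_div₀, map_one, map_natCast, mul_one_div]
  by_cases h : Even n
  · rw [if_pos (even_iff_two_dvd.1 h), if_pos h]
  · rw [if_neg (fun h2 => h (even_iff_two_dvd.2 h2)), if_neg h]

/-- `(2m)! = 2^m m! (2m−1)!!`. [cite: RotaKahanerOdlyzko1973, §10 (**), p. 722] -/
theorem factorial_two_mul_eq (m : ℕ) : (2 * m).factorial = 2 ^ m * m.factorial * (2 * m - 1).doubleFactorial := by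
  cases m with
  | zero => rfl
  | succ j =>
    rw [show 2 * (j + 1) = 2 * j + 1 + 1 by ring, Nat.factorial_eq_mul_doubleFactorial,
      show 2 * j + 1 + 1 = 2 * (j + 1) by ring, Nat.doubleFactorial_two_mul]
    congr 2

/-- **(**) The indicator coefficients of the Weierstrass operator `W_v = e^{vD²/2} = Σ_n a_n^{[v]} Dⁿ/n!`:
`a_n^{[v]} = n! [tⁿ] e^{vt²/2} = v^{n/2} · 1·3·5⋯(n−1)` for `n` even** (here `n = 2m`).
[cite: RotaKahanerOdlyzko1973, §10 (**), p. 722] -/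
theorem factorial_mul_coeff_weierstrass (v : K) (m : ℕ) :
    ((2 * m).factorial : K) * PowerSeries.coeff (2 * m)
        ((PowerSeries.rescale (v / 2) (PowerSeries.exp K)).subst ((PowerSeries.X : PowerSeries K) ^ 2)) =
      v ^ m * ((2 * m - 1).doubleFactorial : K) := by
  rw [coeff_rescale_exp_subst_X_sq, if_pos (even_two_mul m), Nat.mul_div_cancel_left m two_pos,
    factorial_two_mul_eq, div_pow]
  have hf : (m.factorial : K) ≠ 0 := Nat.cast_ne_zero.2 (Nat.factorial_ne_zero m)
  have h2 : ((2 : K) ^ m) ≠ 0 := pow_ne_zero m two_ne_zero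
  push_cast
  field_simp

/-- **(**) … and `a_n^{[v]} = 0` for `n` odd** (`n = 2m + 1`). [cite: RotaKahanerOdlyzko1973, §10 (**), p. 722] -/
theorem coeff_weierstrass_odd (v : K) (m : ℕ) :
    PowerSeries.coeff (2 * m + 1)
        ((PowerSeries.rescale (v / 2) (PowerSeries.exp K)).subst ((PowerSeries.X : PowerSeries K) ^ 2)) = 0 := by
  rw [coeff_rescale_exp_subst_X_sq, if_neg (Nat.not_even_iff_odd.2 ⟨m, rfl⟩)]

/-! ## The Hermite cross-sequence -/

/-- **The Hermite polynomials of variance `v`**: `H_n^{[v]} (x) = W_v⁻¹ xⁿ = e^{−vD²/2} xⁿ` (`v ∈ K`;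
defined through (***) `W_v = e^{vD²/2}`, which "always holds").
[cite: RotaKahanerOdlyzko1973, §10 (*)–(***), pp. 721–722] -/
def hermiteVar (v : K) (n : ℕ) : K[X] :=
  expOp ((-(2⁻¹ : K)) • (PowerSeries.X : PowerSeries K) ^ 2) v (X ^ n)

/-- Unfolding. [cite: RotaKahanerOdlyzko1973, §10, p. 721] -/
theorem hermiteVar_eq (v : K) (n : ℕ) :
    hermiteVar v n = expOp ((-(2⁻¹ : K)) • (PowerSeries.X : PowerSeries K) ^ 2) v (X ^ n) :=
  rfl

/-- `H_n^{[v]} = (e^{−(v/2)s}|_{s=D²}) xⁿ`. [cite: RotaKahanerOdlyzko1973, §10 (***), p. 722] -/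
theorem hermiteVar_eq_diffOp (v : K) (n : ℕ) :
    hermiteVar v n =
      diffOp ((PowerSeries.rescale (-(v / 2)) (PowerSeries.exp K)).subst ((PowerSeries.X : PowerSeries K) ^ 2)) (X ^ n) := by
  rw [hermiteVar_eq, expOp_eq, rescale_exp_subst_negHalfSq]

variable (K) in
/-- `e^{−t²/2}` is the tree's `expNegHalfSq`. [cite: RotaKahanerOdlyzko1973, §10 (***), p. 722] -/
theorem rescale_exp_subst_X_sq_eq_expNegHalfSq :
    ((PowerSeries.rescale (-((1 : K) / 2)) (PowerSeries.exp K)).subst ((PowerSeries.X : PowerSeries K) ^ 2) :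
      PowerSeries K) = expNegHalfSq K := by
  ext n
  rw [coeff_rescale_exp_subst_X_sq, expNegHalfSq, PowerSeries.coeff_mk, neg_div]

/-- **"The ordinary Hermite polynomials correspond to variance one"**: `H_n^{[1]} = He_n` (Mathlib's
`Polynomial.hermite`, mapped to `K`). [cite: RotaKahanerOdlyzko1973, §10, p. 721] -/
theorem hermiteVar_one (n : ℕ) : hermiteVar (1 : K) n = Polynomial.map (Int.castRingHom K) (hermite n) := by
  rw [hermiteVar_eq_diffOp, rescale_exp_subst_X_sq_eq_expNegHalfSq, hermite_eq_diffOp_X_pow]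

/-- `H_n^{[0]} = xⁿ`. [cite: RotaKahanerOdlyzko1973, §10, p. 722] -/
theorem hermiteVar_zero_left (n : ℕ) : hermiteVar (0 : K) n = X ^ n := by
  rw [hermiteVar_eq, expOp_zero, LinearMap.id_apply]

/-- `H_0^{[v]} = 1`. [cite: RotaKahanerOdlyzko1973, §10, p. 721] -/
theorem hermiteVar_zero_right (v : K) : hermiteVar v 0 = 1 := by
  rw [hermiteVar_eq, pow_zero, expOp_apply_one (constantCoeff_negHalfSq K)]

/-- **"We infer that `H_n^{[v]}` is a cross-sequence"** (Theorem 8 with `P^{−v} = e^{vF} = W_v⁻¹`).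
[cite: RotaKahanerOdlyzko1973, §10 ((***) ff.), p. 722] -/
theorem isCrossSequence_hermiteVar : IsCrossSequence (hermiteVar (K := K)) :=
  isCrossSequence_expOp (constantCoeff_negHalfSq K) isBinomialType_X_pow

/-- **`H_n^{[v+μ]} (x + y) = Σ_{k=0}^{n} C(n,k) H_k^{[v]} (x) H_{n−k}^{[μ]} (y)`.**
[cite: RotaKahanerOdlyzko1973, §10, p. 722] -/
theorem hermiteVar_add_eval_add (v μ : K) (n : ℕ) (x y : K) :
    (hermiteVar (v + μ) n).eval (x + y) =
      ∑ k ∈ range (n + 1), (n.choose k : K) * (hermiteVar v k).eval x * (hermiteVar μ (n - k)).eval y :=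
  isCrossSequence_hermiteVar.eval_add v μ n x y

/-- **`H^{[v]}` is an Appell set** for each `v`. [cite: RotaKahanerOdlyzko1973, §10 (*), p. 721] -/
theorem isAppellSequence_hermiteVar (v : K) : IsAppellSequence (hermiteVar v) :=
  isBasicSequence_derivative_X_pow.isShefferSequence_map isDeltaOperator_derivative (isShiftInvariant_expOp _ v)
    (by rw [expOp_apply_one (constantCoeff_negHalfSq K)]; exact one_ne_zero)

/-- **`D H_n^{[v]} = n H_{n−1}^{[v]}`.** [cite: RotaKahanerOdlyzko1973, §10, p. 721] -/
theorem derivative_hermiteVar_succ (v : K) (n : ℕ) :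
    derivative (hermiteVar v (n + 1)) = ((n + 1 : ℕ) : K) • hermiteVar v n :=
  (isAppellSequence_hermiteVar v).map_succ n

/-- **`H_n^{[v]} (x + y) = Σ_k C(n,k) y^{n−k} H_k^{[v]} (x)`** (the Appell identity, written
`Σ_k C(n,k) xᵏ H_{n−k}^{[v]} (y)`). [cite: RotaKahanerOdlyzko1973, §10, p. 721] -/
theorem hermiteVar_eval_add (v : K) (n : ℕ) (x y : K) :
    (hermiteVar v n).eval (x + y) = ∑ k ∈ range (n + 1), (n.choose k : K) * x ^ k * (hermiteVar v (n - k)).eval y :=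
  (isAppellSequence_hermiteVar v).eval_add n x y

/-- **The umbral composition formula `H^{[v]} (H^{[μ]} (x)) = H^{[v+μ]} (x)`** (Proposition 5 of §8).
[cite: RotaKahanerOdlyzko1973, §10, p. 722] [cite: RotaKahanerOdlyzko1973, §8 Proposition 5, p. 715] -/
theorem umbralComp_hermiteVar (v μ : K) : umbralComp (hermiteVar v) (hermiteVar μ) = hermiteVar (v + μ) :=
  umbralComp_expOp_X_pow (constantCoeff_negHalfSq K) v μ

/-- **The explicit coefficients**: `H_n^{[v]} (x) = Σ_{j even} (−v/2)^{j/2}/(j/2)! · (n)_j x^{n−j}`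
(`= Σ_k C(n,2k) a_{2k}^{[−v]} x^{n−2k}` with (**)). [cite: RotaKahanerOdlyzko1973, §10, p. 722] -/
theorem hermiteVar_eq_sum (v : K) (n : ℕ) :
    hermiteVar v n = ∑ j ∈ range (n + 1),
      ((if Even j then (-(v / 2)) ^ (j / 2) / ((j / 2).factorial : K) else 0) * (n.descFactorial j : K)) •
        X ^ (n - j) := by
  rw [hermiteVar_eq_diffOp, diffOp_apply_X_pow]
  refine sum_congr rfl fun j _ => ?_
  rw [coeff_rescale_exp_subst_X_sq]

/-- The odd-gap coefficients vanish and the even ones are `C(n,2k) (−v)^k (2k−1)!!`: the coefficient of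
`x^{n−2k}` in `H_n^{[v]}` (for `2k ≤ n`). [cite: RotaKahanerOdlyzko1973, §10 (**) , p. 722] -/
theorem coeff_hermiteVar (v : K) {n k : ℕ} (hk : 2 * k ≤ n) :
    (hermiteVar v n).coeff (n - 2 * k) = (n.choose (2 * k) : K) * ((-v) ^ k * ((2 * k - 1).doubleFactorial : K)) := by
  rw [hermiteVar_eq_sum, finsetSum_coeff, sum_eq_single (2 * k)]
  · rw [coeff_smul, coeff_X_pow, if_pos rfl, smul_eq_mul, mul_one, if_pos (even_two_mul k),
      Nat.mul_div_cancel_left k two_pos, Nat.descFactorial_eq_factorial_mul_choose, show -(v / 2) = -v / 2 by ring,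
      ← factorial_mul_coeff_weierstrass (-v) k, coeff_rescale_exp_subst_X_sq, if_pos (even_two_mul k),
      Nat.mul_div_cancel_left k two_pos]
    push_cast
    ring
  · intro j hj hjk
    rw [coeff_smul, coeff_X_pow]
    by_cases hj2 : n - 2 * k = n - j
    · have hjn : j ≤ n := Nat.lt_succ_iff.1 (mem_range.1 hj)
      omega
    · rw [if_neg hj2, smul_zero]
  · intro h
    exact absurd (mem_range.2 (by omega)) h

/-- **The generating function `Σ_n H_n^{[v]} (x) tⁿ/n! = e^{xt − vt²/2}`** (Section 5, Proposition 5 —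
the tree's `egf_sheffer` with `Q = D`). [cite: RotaKahanerOdlyzko1973, §10, p. 723]
[cite: RotaKahanerOdlyzko1973, §5 Proposition 5, p. 702] -/
theorem egf_hermiteVar (v a : K) :
    (PowerSeries.mk fun n => (hermiteVar v n).eval a / (n.factorial : K)) =
      (PowerSeries.rescale (-(v / 2)) (PowerSeries.exp K)).subst ((PowerSeries.X : PowerSeries K) ^ 2) *
        PowerSeries.rescale a (PowerSeries.exp K) := by
  have h := isDeltaOperator_derivative.egf_sheffer (K := K) diffOp_X.symm isBasicSequence_derivative_X_pow
    ((PowerSeries.rescale (-(v / 2)) (PowerSeries.exp K)).subst ((PowerSeries.X : PowerSeries K) ^ 2))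
    (s := hermiteVar v) (fun n => (hermiteVar_eq_diffOp v n).symm) a
  rwa [isDeltaOperator_derivative.indicator_self, PowerSeries.X_subst] at h

/-! ## The recurrence, the Rodrigues-type formula and the eigen-equation -/

/-- `(e^{cs})′ = c e^{cs}`. [cite: RotaKahanerOdlyzko1973, §10, p. 723] -/
theorem derivative_rescale_exp (c : K) :
    PowerSeries.derivative K (PowerSeries.rescale c (PowerSeries.exp K)) = c • PowerSeries.rescale c (PowerSeries.exp K) := by
  ext n
  rw [PowerSeries.coeff_derivative, PowerSeries.coeff_rescale, map_smul, PowerSeries.coeff_rescale, PowerSeries.coeff_exp,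
    PowerSeries.coeff_exp, smul_eq_mul, map_div₀, map_div₀, map_one, map_natCast, map_natCast, Nat.factorial_succ,
    Nat.cast_mul, pow_succ]
  have hn : ((n + 1 : ℕ) : K) ≠ 0 := Nat.cast_ne_zero.2 (Nat.succ_ne_zero n)
  have hf : (n.factorial : K) ≠ 0 := Nat.cast_ne_zero.2 (Nat.factorial_ne_zero n)
  field_simp
  push_cast
  ring

/-- **`(e^{−vt²/2})′ = −vt · e^{−vt²/2}`** — the Pincherle derivative of `W_v⁻¹` is `−vD W_v⁻¹`.
[cite: RotaKahanerOdlyzko1973, §10 (proof of the Rodrigues formula), p. 723] -/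
theorem derivative_weierstrassInv (v : K) :
    PowerSeries.derivative K ((PowerSeries.rescale (-(v / 2)) (PowerSeries.exp K)).subst
        ((PowerSeries.X : PowerSeries K) ^ 2)) =
      -(v • ((PowerSeries.rescale (-(v / 2)) (PowerSeries.exp K)).subst
        ((PowerSeries.X : PowerSeries K) ^ 2) * PowerSeries.X)) := by
  have hX2 : PowerSeries.HasSubst ((PowerSeries.X : PowerSeries K) ^ 2) := PowerSeries.HasSubst.X_pow two_ne_zero
  have hX : PowerSeries.derivative K ((PowerSeries.X : PowerSeries K) ^ 2) = PowerSeries.X + PowerSeries.X := by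
    rw [pow_two, Derivation.leibniz, PowerSeries.derivative_X, smul_eq_mul, mul_one]
  rw [PowerSeries.derivative_subst (hg := hX2), derivative_rescale_exp, PowerSeries.subst_smul hX2, hX,
    smul_mul_assoc, mul_add, smul_add, ← add_smul, show -(v / 2) + -(v / 2) = -v by ring, neg_smul]

/-- **The recurrence `H_{n+1}^{[v]} = x H_n^{[v]} − v (H_n^{[v]})′`** (`W_v⁻¹ x = (x − vD) W_v⁻¹` by the
Pincherle derivative; printed for `v = 1`: `H_{n+1} = x H_n − H_n′`).
[cite: RotaKahanerOdlyzko1973, §10, p. 723] -/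
theorem hermiteVar_succ (v : K) (n : ℕ) :
    hermiteVar v (n + 1) = X * hermiteVar v n - v • derivative (hermiteVar v n) := by
  have hx : (X : K[X]) ^ (n + 1) = X * X ^ n := by rw [pow_succ']
  rw [hermiteVar_eq_diffOp, hermiteVar_eq_diffOp, hx, X_mul_diffOp, derivative_weierstrassInv,
    diffOp_neg, LinearMap.neg_apply, sub_neg_eq_add, diffOp_smul, LinearMap.smul_apply, diffOp_mul, diffOp_X,
    LinearMap.comp_apply, ← derivative_diffOp]
  abel

/-- **… `= x H_n^{[v]} − v n H_{n−1}^{[v]}`** (printed for `v = 1`: `H_{n+1} = x H_n − n H_{n−1}`).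
[cite: RotaKahanerOdlyzko1973, §10, p. 723] -/
theorem hermiteVar_succ' (v : K) (n : ℕ) :
    hermiteVar v (n + 2) = X * hermiteVar v (n + 1) - (v * ((n + 1 : ℕ) : K)) • hermiteVar v n := by
  rw [hermiteVar_succ, derivative_hermiteVar_succ, smul_smul]

/-- **The Rodrigues-type formula `H_n^{[v]} = (x − vD)ⁿ 1`** ("setting `f (x) = x^{n−1}` and iterating").
[cite: RotaKahanerOdlyzko1973, §10, p. 723] -/
theorem hermiteVar_eq_iterate (v : K) (n : ℕ) :
    hermiteVar v n = (fun f : K[X] => X * f - v • derivative f)^[n] 1 := by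
  induction n with
  | zero => rw [Function.iterate_zero_apply, hermiteVar_zero_right]
  | succ n ih => rw [Function.iterate_succ_apply', ← ih, hermiteVar_succ]

/-- **The eigen-equation `x (H_n^{[v]})′ − v (H_n^{[v]})″ = n H_n^{[v]}`**: the Hermite polynomials of
variance `v` are eigenfunctions with eigenvalues `n` of `A_v = xD − vD²` (Theorem 9 with `(log W_v)′ = vD`;
printed for `v = 1`). [cite: RotaKahanerOdlyzko1973, §10, p. 726] -/
theorem X_mul_derivative_hermiteVar_sub (v : K) (n : ℕ) :
    X * derivative (hermiteVar v n) - v • derivative (derivative (hermiteVar v n)) = (n : K) • hermiteVar v n := by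
  rcases n with _ | m
  · rw [hermiteVar_zero_right, derivative_one, derivative_zero, mul_zero, smul_zero, sub_zero, Nat.cast_zero,
      zero_smul]
  · -- `x H′_{m+1} = (m+1) x H_m = (m+1) (H_{m+1} + v H_m′)` and `H″_{m+1} = (m+1) H_m′`
    have h := hermiteVar_succ v m
    rw [derivative_hermiteVar_succ, derivative_smul, mul_smul_comm, smul_comm v, ← smul_sub, ← h]

end Literature.Algebra.Polynomial
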